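import Summits.CriticalPhenomena.PercolationContinuityZ3.Theorems.PercNearOneGluingNoHeavyLowerTailSahiSlotCell34Facts
import Summits.CriticalPhenomena.PercolationContinuityZ3.Theorems.PercNearOneGluingNoHeavyLowerTailSahiSlotPatternCopyKernel
import Summits.CriticalPhenomena.PercolationContinuityZ3.Theorems.SahiGridPatternOrderNFour

/-!
# The cell `(3,4)` in the kernel, IV: IDENTIFICATION — the checker's `Φ` is `sStarN 4 3 = patternForm 3 4`

Support file of the one-cut programme (crux `NoHeavyLowerTail`, stmt-CriticalPhenomena-4575; cell `prim-masterthm`, seat P3, gen 19;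
`run/shared/lean/prim/prim-masterthm/prim-masterthm-p3/HIERARCHY.md` §27).  Companion of `…SahiSlotCell34Check` / `…Facts`.

A family of down-masks `d : Fin 4 → ℕ` has members `memb d i = {q ∈ [4]^3 | code q ∉ d i}` (`code q = 16 q₀ + 4 q₁ + q₂`).  THEOREM
**`sStarN_memb : sStarN 4 3 (memb d) = phiRef d`** and hence **`patternForm_memb : patternForm 3 4 (1_{memb d}) = phiRef d`**
(through P3's `sStarN_cast_eq_patternForm`).  PROOF: prim-sahi's `sStarN 4 3 A = Σ_{π : Fin 3 → S_4} K₄(incMatrix A (col π))` with `K₄` in the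
closed form `copyKernel_four`; the pattern `π` is the ORDERED transversal `c ↦ (π₀ c, π₁ c, π₂ c)`, i.e. the unordered transversal
`L = (π₁π₀⁻¹, π₂π₀⁻¹)` (numbered `24·idx + idx` in the checker's lexicographic list of `S_4`) read in the order `π₀`; so the sum over `π` is the
sum over `(L, ρ) ∈ 576 × 24` of `K₄(M_L ∘ ρ)` (`Finset.sum_bij`, the indexing `idx` of `S_4` checked by evaluation), which is `Σ_L Ψ(M_L) = phiRef`
by the definition of `psiSlow`.  The entries agree because `transCell L (ρ c) = code (col π c)`.
HONEST LABEL: an identity; no claim about `(3,4)` here. [this work]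
-/

namespace Summit.CriticalPhenomena.PercolationContinuityZ3.Theorems

namespace SahiSlot34

open Finset Equiv
open SahiCopyKernel (copyKernel incMatrix)
open SahiGridPatternN (col sStarN copyKernel_four)
open Literature.Combinatorics.Sahi2008 (setInd)

/-! ### Points and members -/

/-- The code `16 q₀ + 4 q₁ + q₂ < 64` of a point of the slot cube `[4]^3`. [this work] -/
def code (q : SahiSlot.Q 3 4) : ℕ := 16 * (q 0).val + 4 * (q 1).val + (q 2).val

/-- Codes are `< 64`. [this work] -/
theorem code_lt (q : SahiSlot.Q 3 4) : code q < 64 := by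
  unfold code; have := (q 0).isLt; have := (q 1).isLt; have := (q 2).isLt; omega

/-- The members of the family with down-masks `d`: member `i` = the points whose code is NOT a bit of `d i`. [this work] -/
def memb (d : Fin 4 → ℕ) (i : Fin 4) : Finset (SahiSlot.Q 3 4) := univ.filter fun q => (d i).testBit (code q) = false

/-- Membership in a member. [this work] -/
theorem mem_memb {d : Fin 4 → ℕ} {i : Fin 4} {q : SahiSlot.Q 3 4} : q ∈ memb d i ↔ (d i).testBit (code q) = false := by
  unfold memb; simp

/-! ### Indexing `S_4` by the checker's lexicographic list -/

/-- The index of a permutation of `Fin 4` in the list `permL` (found by search). [this work] -/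
def idx (σ : Perm (Fin 4)) : ℕ :=
  ((List.range 24).find? fun k => (List.range 4).all fun j => pm k j == (σ ⟨j % 4, Nat.mod_lt _ (by norm_num)⟩).val).getD 0

/-- The index is `< 24` and names the permutation (by evaluation over the 24 permutations). [this work] -/
theorem idx_spec : ∀ σ : Perm (Fin 4), idx σ < 24 ∧ ∀ j : Fin 4, pm (idx σ) j.val = (σ j).val := by native_decide

/-- Every index `< 24` is attained (by evaluation). [this work] -/
theorem idx_surj : ∀ k : Fin 24, ∃ σ : Perm (Fin 4), idx σ = k.val := by native_decide

attribute [irreducible] idx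

/-- `idx` is injective. [this work] -/
theorem idx_injective {σ τ : Perm (Fin 4)} (h : idx σ = idx τ) : σ = τ := by
  ext j
  have h1 := (idx_spec σ).2 j
  have h2 := (idx_spec τ).2 j
  rw [h] at h1
  rw [Fin.ext (h1.symm.trans h2)]

/-! ### The pattern of an ordered transversal -/

/-- The ordering of the pattern `π`: its first axis. [this work] -/
def rOf (π : Fin 3 → Perm (Fin 4)) : ℕ := idx (π 0)
/-- The unordered transversal of the pattern `π`, as its number `24 a + b`. [this work] -/
def LOf (π : Fin 3 → Perm (Fin 4)) : ℕ := 24 * idx (π 1 * (π 0)⁻¹) + idx (π 2 * (π 0)⁻¹)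

/-- `rOf < 24`. [this work] -/
theorem rOf_lt (π : Fin 3 → Perm (Fin 4)) : rOf π < 24 := (idx_spec _).1
/-- `LOf < 576`. [this work] -/
theorem LOf_lt (π : Fin 3 → Perm (Fin 4)) : LOf π < 576 := by
  unfold LOf; have := (idx_spec (π 1 * (π 0)⁻¹)).1; have := (idx_spec (π 2 * (π 0)⁻¹)).1; omega

/-- The cell in position `π₀ c` of the transversal of `π` is the point `col π c`. [this work] -/
theorem transCell_LOf (π : Fin 3 → Perm (Fin 4)) (c : Fin 4) : transCell (LOf π) (pm (rOf π) c.val) = code (col π c) := by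
  have hb := (idx_spec (π 2 * (π 0)⁻¹)).1
  have h1 : LOf π / 24 = idx (π 1 * (π 0)⁻¹) := by unfold LOf; omega
  have h2 : LOf π % 24 = idx (π 2 * (π 0)⁻¹) := by unfold LOf; omega
  have hr : pm (rOf π) c.val = (π 0 c).val := (idx_spec (π 0)).2 c
  have ha : pm (idx (π 1 * (π 0)⁻¹)) (π 0 c).val = (π 1 c).val := by
    rw [(idx_spec (π 1 * (π 0)⁻¹)).2 (π 0 c), Perm.mul_apply, Perm.inv_def, Equiv.symm_apply_apply]
  have hb' : pm (idx (π 2 * (π 0)⁻¹)) (π 0 c).val = (π 2 c).val := by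
    rw [(idx_spec (π 2 * (π 0)⁻¹)).2 (π 0 c), Perm.mul_apply, Perm.inv_def, Equiv.symm_apply_apply]
  unfold transCell code
  rw [h1, h2, hr, ha, hb']
  rfl

/-- The entries agree: `incMatrix (memb d) (col π) i c = [bit (i, π₀ c… ) of the relabelled pattern]`. [this work] -/
theorem incMatrix_eq_bt (d : Fin 4 → ℕ) (π : Fin 3 → Perm (Fin 4)) (i c : Fin 4) :
    incMatrix (memb d) (col π) i c = bt (colPerm (rOf π) (patOf d (LOf π))) i.val c.val := by
  have hj : pm (rOf π) c.val < 4 := by unfold rOf; rw [(idx_spec (π 0)).2 c]; exact (π 0 c).isLt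
  unfold incMatrix bt colPerm
  rw [testBit_ofBits, testBit_patOf]
  have h16 : 4 * i.val + c.val < 16 := by omega
  have hdiv : (4 * i.val + c.val) / 4 = i.val := by omega
  have hmod : (4 * i.val + c.val) % 4 = c.val := by omega
  have h16' : 4 * i.val + pm (rOf π) c.val < 16 := by omega
  have hdiv' : (4 * i.val + pm (rOf π) c.val) / 4 % 4 = i.val := by omega
  have hmod' : (4 * i.val + pm (rOf π) c.val) % 4 = pm (rOf π) c.val := by omega
  have hfi : (⟨(4 * i.val + pm (rOf π) c.val) / 4 % 4, Nat.mod_lt _ (by norm_num)⟩ : Fin 4) = i := Fin.ext hdiv'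
  simp only [h16, decide_true, Bool.true_and, hdiv, hmod, h16', hfi, hmod', transCell_LOf, mem_memb]
  cases (d i).testBit (code (col π c)) <;> simp

/-! ### `K₄` as one polynomial in the sixteen entries -/

/-- The closed form of `K₄` (prim-sahi's `copyKernel_four`) as a function of the matrix. [this work] -/
def P4 (M : Fin 4 → Fin 4 → ℤ) : ℤ :=
  6 * (M 0 3 * M 1 3 * M 2 3 * M 3 3)
  - 2 * (M 1 3 * M 2 3 * M 3 3 * M 0 0 + M 0 3 * M 2 3 * M 3 3 * M 1 1 + M 0 3 * M 1 3 * M 3 3 * M 2 2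
          + M 0 2 * M 1 2 * M 2 2 * M 3 3)
  - (M 0 1 * M 1 1 * (M 2 3 * M 3 3) + M 0 2 * M 2 2 * (M 1 3 * M 3 3) + M 0 3 * M 3 3 * (M 1 2 * M 2 2))
  + (M 0 1 * M 1 1 * M 2 2 * M 3 3 + M 0 2 * M 2 2 * M 1 1 * M 3 3 + M 0 3 * M 3 3 * M 1 1 * M 2 2
      + M 1 2 * M 2 2 * M 0 0 * M 3 3 + M 1 3 * M 3 3 * M 0 0 * M 2 2 + M 2 3 * M 3 3 * M 0 0 * M 1 1)
  - M 0 0 * M 1 1 * M 2 2 * M 3 3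

/-- `copyKernel 4 = P4` (prim-sahi's `copyKernel_four`). -/
theorem copyKernel_eq_P4 (M : Fin 4 → Fin 4 → ℤ) : copyKernel 4 M = P4 M := copyKernel_four M

/-- The checker's `k4` is `P4` read on the bits of the pattern. [this work] -/
theorem k4_eq_P4 (m : ℕ) : k4 m = P4 (fun i c => bt m i.val c.val) := rfl

/-! ### The identification -/

/-- A list sum over `List.range` is a `Finset.range` sum. [this work] -/
theorem sum_map_range (n : ℕ) (f : ℕ → ℤ) : ((List.range n).map f).sum = ∑ r ∈ range n, f r := by
  induction n with
  | zero => simp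
  | succ n ih => rw [List.range_succ, List.map_append, List.sum_append, ih, sum_range_succ]; simp

/-- `psiSlow` as a `Finset` sum. [this work] -/
theorem psiSlow_eq_sum (m : ℕ) : psiSlow m = ∑ r ∈ range 24, k4 (colPerm r m) := by
  unfold psiSlow; rw [sum_map_range]

/-- The reindexing map is injective. [this work] -/
theorem eq_of_LOf_rOf_eq {π π' : Fin 3 → Perm (Fin 4)} (hL : LOf π = LOf π') (hr : rOf π = rOf π') : π = π' := by
  have h0 : π 0 = π' 0 := idx_injective hr
  have hb := (idx_spec (π 2 * (π 0)⁻¹)).1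
  have hb' := (idx_spec (π' 2 * (π' 0)⁻¹)).1
  unfold LOf at hL
  have ha : idx (π 1 * (π 0)⁻¹) = idx (π' 1 * (π' 0)⁻¹) := by omega
  have hbb : idx (π 2 * (π 0)⁻¹) = idx (π' 2 * (π' 0)⁻¹) := by omega
  have h1 : π 1 = π' 1 := by
    have := idx_injective ha
    rw [h0] at this
    exact mul_right_cancel this
  have h2 : π 2 = π' 2 := by
    have := idx_injective hbb
    rw [h0] at this
    exact mul_right_cancel this
  funext a
  fin_cases a
  · exact h0
  · exact h1
  · exact h2

/-- The reindexing map is surjective. [this work] -/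
theorem exists_LOf_rOf_eq {L r : ℕ} (hL : L < 576) (hr : r < 24) : ∃ π : Fin 3 → Perm (Fin 4), LOf π = L ∧ rOf π = r := by
  obtain ⟨σr, hσr⟩ := idx_surj ⟨r, hr⟩
  obtain ⟨σa, hσa⟩ := idx_surj ⟨L / 24, by omega⟩
  obtain ⟨σb, hσb⟩ := idx_surj ⟨L % 24, by omega⟩
  refine ⟨![σr, σa * σr, σb * σr], ?_, ?_⟩
  · have e0 : (![σr, σa * σr, σb * σr] : Fin 3 → Perm (Fin 4)) 0 = σr := rfl
    have e1 : (![σr, σa * σr, σb * σr] : Fin 3 → Perm (Fin 4)) 1 = σa * σr := rfl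
    have e2 : (![σr, σa * σr, σb * σr] : Fin 3 → Perm (Fin 4)) 2 = σb * σr := rfl
    unfold LOf
    rw [e0, e1, e2, mul_inv_cancel_right, mul_inv_cancel_right, hσa, hσb]
    simp only
    omega
  · exact hσr

/-- The summands agree. [this work] -/
theorem copyKernel_incMatrix_eq (d : Fin 4 → ℕ) (π : Fin 3 → Perm (Fin 4)) :
    copyKernel 4 (incMatrix (memb d) (col π)) = k4 (colPerm (rOf π) (patOf d (LOf π))) := by
  rw [copyKernel_eq_P4, k4_eq_P4]
  congr 1
  funext i c
  exact incMatrix_eq_bt d π i c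

/-- The image of the reindexing map is all of `576 × 24`. [this work] -/
theorem image_LOf_rOf : (univ : Finset (Fin 3 → Perm (Fin 4))).image (fun π => (LOf π, rOf π)) = range 576 ×ˢ range 24 := by
  ext Lr
  obtain ⟨L, r⟩ := Lr
  rw [mem_image, mem_product, mem_range, mem_range]
  constructor
  · rintro ⟨π, -, h⟩
    rw [Prod.mk.injEq] at h
    rw [← h.1, ← h.2]
    exact ⟨LOf_lt π, rOf_lt π⟩
  · rintro ⟨hL, hr⟩
    obtain ⟨π, h1, h2⟩ := exists_LOf_rOf_eq hL hr
    exact ⟨π, mem_univ _, by rw [h1, h2]⟩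

/-- **IDENTIFICATION.**  The transversal form `phiRef` IS prim-sahi's `sStarN 4 3` of the member family. [this work] -/
theorem sStarN_memb (d : Fin 4 → ℕ) : sStarN 4 3 (memb d) = phiRef d := by
  have hR : phiRef d = ∑ x ∈ range 576 ×ˢ range 24, k4 (colPerm x.2 (patOf d x.1)) := by
    unfold phiRef
    rw [sum_product]
    exact sum_congr rfl fun L _ => psiSlow_eq_sum _
  have hL : sStarN 4 3 (memb d) = ∑ π : Fin 3 → Perm (Fin 4), k4 (colPerm (rOf π) (patOf d (LOf π))) := by
    unfold sStarN
    exact sum_congr rfl fun π _ => copyKernel_incMatrix_eq d π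
  rw [hR, hL, ← image_LOf_rOf, sum_image]
  intro π _ π' _ h
  rw [Prod.mk.injEq] at h
  exact eq_of_LOf_rOf_eq h.1 h.2

/-- **IDENTIFICATION, pattern form**: `patternForm 3 4 (1_{memb d}) = phiRef d`. [this work] -/
theorem patternForm_memb (d : Fin 4 → ℕ) : SahiSlot.patternForm 3 4 (fun i => setInd (memb d i)) = (phiRef d : ℝ) := by
  rw [← sStarN_memb, SahiSlot.sStarN_cast_eq_patternForm (by norm_num)]

end SahiSlot34

end Summit.CriticalPhenomena.PercolationContinuityZ3.Theorems
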